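import Summits.RiemannHypothesis.RiemannHypothesis.Theses.UniversalFactor
import Literature.NumberTheory.LFunctions.DeBruijnHDiv
import Literature.NumberTheory.LFunctions.DeBruijnNewmanConstProofs
import Literature.Analysis.Complex.DeBruijnUniversalFactorsProofs
import Literature.Analysis.Complex.JensenCircles

/-!
# RiemannHypothesis / UniversalFactor — the Laguerre lift and the assembly `X → RH`

Route `RiemannHypothesis/UniversalFactor` (Cardon's loophole). With `Φ = deBruijnPhi` and, for a
real `a`, the Laplace-smoothed de Bruijn transform
`F_a(z) = ∫₀^∞ Φ(u) (1 + u²/a²)⁻¹ cos(zu) du = deBruijnHDiv (fun u ↦ 1 + u²/a²) z`,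
this file proves, sorry-free and unconditionally:

* `UniversalFactor.laguerre_step` — **Laguerre's theorem, Hadamard-free**: if `f` is a real entire
  function of order `< 2` (`‖f(z)‖ ≤ C e^{‖z‖^ρ}`, `0 ≤ ρ < 2`, `f(ℝ) ⊆ ℝ`) with only real zeros
  and `c` is real, then `f' + c f` is either `≡ 0` or has only real zeros. (Off the axis
  `Im (f'/f) ≠ 0` strictly as soon as `f` has a zero — `im_mul_im_logDeriv_le` of
  `LaguerrePolya.lean`; a zero-free such `f` has `f'/f` a real constant.)
* `UniversalFactor.isAdmissible_laplaceKernel`, `UniversalFactor.trigIntegral_laplaceKernel`: the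
  even kernel `Φ(|s|)/(1 + s²/a²)` is de Bruijn-admissible and its trigonometric integral is `2 F_a`,
  so `F_a` is real entire of order `< 2` (de Bruijn 1950, Thm. 10 = `IsAdmissible.exists_order_bound`).
* `UniversalFactor.laguerreLift` — the route decl **`LaguerreLift`** (item stmt-RiemannHypothesis-2579):
  for `a > 0`, if `F_a` has only real zeros then so has `H_0 = F_a − F_a''/a² = −(G' − aG)/a²`,
  `G = F_a' + a F_a` (two Laguerre steps; the degenerate alternatives are excluded by `H_0 ≢ 0`).
* `UniversalFactor.assembly` — the route decl **`Assembly`** (item stmt-RiemannHypothesis-2584):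
  `LaplaceLoophole → RiemannHypothesis`, by `laguerreLift` and the tree's
  `riemannHypothesis_iff_hasOnlyRealZeros_deBruijnH_zero_holds` (`RH ↔ H_0` real-rooted).

Nothing here decides the target `LaplaceLoophole` (expected false); the file is
`--supports stmt-RiemannHypothesis-2575` and closes the decls `LaguerreLift`, `Assembly` verbatim.

References: N. G. de Bruijn, Duke Math. J. 17 (1950), Thm. 10; E. Laguerre, Œuvres I, pp. 167–180
(closure of the Laguerre–Pólya class under `D + c`); D. A. Cardon, Proc. AMS 130 (2002), §3 Q. 7.
-/

noncomputable section

namespace Summit.RiemannHypothesis.RiemannHypothesis.Theorems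

open MeasureTheory Set Filter
open Literature.NumberTheory.LFunctions Literature.Analysis.Complex
open Summit.RiemannHypothesis.RiemannHypothesis.Theses

/-! ## Real-valued entire functions are constant; Laguerre's step -/

/-- An entire function all of whose values are real is constant (open mapping theorem).
[folklore] -/
theorem UniversalFactor.apply_eq_apply_of_im_eq_zero {g : ℂ → ℂ} (hg : Differentiable ℂ g)
    (him : ∀ z, (g z).im = 0) (z w : ℂ) : g z = g w := by
  have hga : AnalyticOnNhd ℂ g univ := hg.differentiableOn.analyticOnNhd isOpen_univ
  rcases hga.is_constant_or_isOpenMap with ⟨c, hc⟩ | hopen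
  · rw [hc z, hc w]
  · exfalso
    have hU : IsOpen (g '' univ) := by simpa using hopen univ isOpen_univ
    obtain ⟨δ, hδ, hball⟩ := Metric.isOpen_iff.1 hU (g 0) ⟨0, mem_univ _, rfl⟩
    have hmem : g 0 + Complex.I * (δ / 2 : ℝ) ∈ Metric.ball (g 0) δ := by
      rw [Metric.mem_ball, dist_eq_norm]
      have : ‖Complex.I * ((δ / 2 : ℝ) : ℂ)‖ = δ / 2 := by
        rw [norm_mul, Complex.norm_I, one_mul, Complex.norm_real, Real.norm_eq_abs,
          abs_of_pos (by positivity)]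
      simp only [add_sub_cancel_left, this]
      linarith
    obtain ⟨u, -, hu⟩ := hball hmem
    have := him u
    rw [hu] at this
    simp [him 0] at this
    exact hδ.ne' this

/-- **Laguerre's step (Hadamard-free).** Let `f` be entire with `‖f(z)‖ ≤ C e^{‖z‖^ρ}`
(`0 ≤ ρ < 2`), real on the real axis and with only real zeros, and let `c` be real. Then
`f' + c f` either vanishes identically or has only real zeros. Proof: at a non-real `z`,
`f(z) ≠ 0`; if `f` has a zero `a` then `(Im z)·Im (f'/f)(z) ≤ −(Im z)²/‖z − a‖² < 0`
(`im_mul_im_logDeriv_le`), so `f'/f(z) ≠ −c`; if `f` is zero-free then `f'/f + c` is a real-valued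
entire function, hence constant. (Classically: `f ∈ 𝓛𝓟 ⇒ e^{cz} f ∈ 𝓛𝓟 ⇒ (e^{cz} f)' ∈ 𝓛𝓟`.)
[folklore] -/
theorem UniversalFactor.laguerre_step {f : ℂ → ℂ} (hf : Differentiable ℂ f) {ρ C : ℝ}
    (hρ0 : 0 ≤ ρ) (hρ : ρ < 2) (hgr : ∀ z, ‖f z‖ ≤ C * Real.exp (‖z‖ ^ ρ))
    (hreal : ∀ x : ℝ, (f x).im = 0) (hzero : ∀ z, f z = 0 → z.im = 0) (c : ℝ) :
    (∀ z, deriv f z + c * f z = 0) ∨ (∀ z, deriv f z + c * f z = 0 → z.im = 0) := by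
  by_cases hex : ∃ a, f a = 0
  · obtain ⟨a, ha⟩ := hex
    refine Or.inr fun z hz ↦ ?_
    by_contra hzim
    have hfz : f z ≠ 0 := fun h ↦ hzim (hzero z h)
    have hq : deriv f z / f z = -(c : ℂ) := by
      rw [div_eq_iff hfz]; linear_combination hz
    have him : (deriv f z / f z).im = 0 := by rw [hq]; simp
    have key := im_mul_im_logDeriv_le hf hρ0 hρ hgr hreal hzero hzim ha
    rw [him, mul_zero] at key
    have hza : z - a ≠ 0 := by
      intro h
      apply hzim
      rw [sub_eq_zero.1 h]
      exact hzero a ha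
    have h1 : 0 < z.im ^ 2 := by positivity
    have h2 : 0 < ‖z - a‖ ^ 2 := by positivity
    have hpos : 0 < z.im ^ 2 / ‖z - a‖ ^ 2 := div_pos h1 h2
    linarith
  · push Not at hex
    set g : ℂ → ℂ := fun z ↦ deriv f z / f z + c with hg
    have hgd : Differentiable ℂ g := fun z ↦ ((hf.deriv z).div (hf z) (hex z)).add_const _
    have him : ∀ z, (g z).im = 0 := fun z ↦ by
      simp only [hg, Complex.add_im, Complex.ofReal_im, add_zero]
      exact im_logDeriv_eq_zero_of_forall_ne_zero hf hρ0 hρ hgr hreal hex z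
    have hfg : ∀ z, deriv f z + c * f z = f z * g z := fun z ↦ by
      simp only [hg]
      field_simp [hex z]
    by_cases hg0 : ∃ w, g w = 0
    · obtain ⟨w, hw⟩ := hg0
      refine Or.inl fun z ↦ ?_
      rw [hfg, UniversalFactor.apply_eq_apply_of_im_eq_zero hgd him z w, hw, mul_zero]
    · push Not at hg0
      refine Or.inr fun z hz ↦ ?_
      rw [hfg] at hz
      rcases mul_eq_zero.1 hz with h | h
      · exact absurd h (hex z)
      · exact absurd h (hg0 z)

/-! ## Growth bookkeeping: the class is closed under `f ↦ f' + c f` -/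

/-- Adding two functions of order `< 2` (exponents `0 ≤ ρ₁ ≤ ρ₂`): the sum has exponent `ρ₂`.
[folklore] -/
theorem UniversalFactor.norm_add_le_of_growth {f g : ℂ → ℂ} {ρ₁ ρ₂ C₁ C₂ : ℝ} (hρ₁ : 0 ≤ ρ₁)
    (h12 : ρ₁ ≤ ρ₂) (hf : ∀ z, ‖f z‖ ≤ C₁ * Real.exp (‖z‖ ^ ρ₁))
    (hg : ∀ z, ‖g z‖ ≤ C₂ * Real.exp (‖z‖ ^ ρ₂)) (z : ℂ) :
    ‖f z + g z‖ ≤ (C₁ * Real.exp 1 + C₂) * Real.exp (‖z‖ ^ ρ₂) := by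
  have hC₁ : 0 ≤ C₁ := growthConst_nonneg hf
  have h0 : 0 ≤ ‖z‖ ^ ρ₂ := Real.rpow_nonneg (norm_nonneg z) ρ₂
  have hexp : Real.exp (‖z‖ ^ ρ₁) ≤ Real.exp 1 * Real.exp (‖z‖ ^ ρ₂) := by
    rw [← Real.exp_add]
    apply Real.exp_le_exp.2
    rcases le_or_gt 1 ‖z‖ with h | h
    · have := Real.rpow_le_rpow_of_exponent_le h h12
      linarith
    · have := Real.rpow_le_one (norm_nonneg z) h.le hρ₁
      linarith
  calc ‖f z + g z‖ ≤ ‖f z‖ + ‖g z‖ := norm_add_le _ _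
    _ ≤ C₁ * Real.exp (‖z‖ ^ ρ₁) + C₂ * Real.exp (‖z‖ ^ ρ₂) := add_le_add (hf z) (hg z)
    _ ≤ C₁ * (Real.exp 1 * Real.exp (‖z‖ ^ ρ₂)) + C₂ * Real.exp (‖z‖ ^ ρ₂) := by gcongr
    _ = (C₁ * Real.exp 1 + C₂) * Real.exp (‖z‖ ^ ρ₂) := by ring

/-- If `f` is entire with `‖f(z)‖ ≤ C e^{‖z‖^ρ}` (`0 ≤ ρ < 2`), then `f' + c f` again satisfies
such a bound with an exponent in `[0, 2)` (Cauchy's estimate, `norm_deriv_le_of_growth`).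
[folklore] -/
theorem UniversalFactor.exists_growth_deriv_add_mul {f : ℂ → ℂ} (hf : Differentiable ℂ f)
    {ρ C : ℝ} (hρ0 : 0 ≤ ρ) (hρ : ρ < 2) (hgr : ∀ z, ‖f z‖ ≤ C * Real.exp (‖z‖ ^ ρ)) (c : ℂ) :
    ∃ ρ' C' : ℝ, 0 ≤ ρ' ∧ ρ' < 2 ∧
      ∀ z, ‖deriv f z + c * f z‖ ≤ C' * Real.exp (‖z‖ ^ ρ') := by
  obtain ⟨C₁, h₁⟩ := norm_deriv_le_of_growth hf hρ0 hρ hgr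
  have hC : 0 ≤ C := growthConst_nonneg hgr
  have hcf : ∀ z, ‖c * f z‖ ≤ ‖c‖ * C * Real.exp (‖z‖ ^ ρ) := fun z ↦ by
    rw [norm_mul, mul_assoc]
    exact mul_le_mul_of_nonneg_left (hgr z) (norm_nonneg c)
  refine ⟨(ρ + 2) / 2, ‖c‖ * C * Real.exp 1 + C₁, by positivity, by linarith, fun z ↦ ?_⟩
  have h := UniversalFactor.norm_add_le_of_growth hρ0 (by linarith : ρ ≤ (ρ + 2) / 2) hcf h₁ z
  rwa [add_comm (c * f z)] at h

/-! ## The Laplace kernel `Φ(|s|)/(1 + s²/a²)` is de Bruijn-admissible; `F_a` has order `< 2` -/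

/-- Pointwise domination of the Laplace kernel by de Bruijn's kernel `F_0(s) = Φ(|s|)`:
`‖Φ(|s|)/(1 + s²/a²)‖ ≤ ‖F_0(s)‖` (the multiplier is `≥ 1`). [folklore] -/
theorem UniversalFactor.norm_laplaceKernel_le (a s : ℝ) :
    ‖(((Newman.evenPhi s / (1 + s ^ 2 / a ^ 2) : ℝ) : ℂ))‖ ≤ ‖deBruijnKernel 0 s‖ := by
  have hm : 0 ≤ s ^ 2 / a ^ 2 := by positivity
  have hm_pos : 0 < 1 + s ^ 2 / a ^ 2 := by linarith
  rw [norm_deBruijnKernel, zero_mul, Real.exp_zero, one_mul, Complex.norm_real, Real.norm_eq_abs,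
    abs_of_nonneg (div_nonneg (Newman.evenPhi_nonneg s) hm_pos.le)]
  exact div_le_self (Newman.evenPhi_nonneg s) (by linarith)

/-- **The Laplace kernel is admissible** in de Bruijn's sense (integrable, `K(−s) = K(s)^*` — it is
real and even —, and `K(s) = O(e^{−|s|³})`), being dominated by the admissible kernel `F_0`.
[cite: Bruijn1950, Thm. 10] -/
theorem UniversalFactor.isAdmissible_laplaceKernel (a : ℝ) :
    DeBruijn1950.IsAdmissible (fun s : ℝ ↦ ((Newman.evenPhi s / (1 + s ^ 2 / a ^ 2) : ℝ) : ℂ)) := by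
  have hm_pos : ∀ s : ℝ, 0 < 1 + s ^ 2 / a ^ 2 := fun s ↦ by positivity
  have hcont : Continuous fun s : ℝ ↦ ((Newman.evenPhi s / (1 + s ^ 2 / a ^ 2) : ℝ) : ℂ) :=
    Complex.continuous_ofReal.comp
      (Newman.continuous_evenPhi.div (by fun_prop) fun s ↦ (hm_pos s).ne')
  obtain ⟨C, hC, hle⟩ := exists_norm_deBruijnKernel_le 0
  refine ⟨?_, fun s ↦ ?_, ⟨3, C, by norm_num, Eventually.of_forall fun s ↦ ?_⟩⟩
  · exact (integrable_deBruijnKernel 0).norm.mono' hcont.aestronglyMeasurable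
      (Eventually.of_forall fun s ↦ UniversalFactor.norm_laplaceKernel_le a s)
  · simp only [Newman.evenPhi_neg, neg_sq, Complex.conj_ofReal]
  · have h1 : Real.exp (-|s|) ≤ 1 := Real.exp_le_one_iff.2 (neg_nonpos.2 (abs_nonneg s))
    calc ‖(((Newman.evenPhi s / (1 + s ^ 2 / a ^ 2) : ℝ) : ℂ))‖ ≤ ‖deBruijnKernel 0 s‖ :=
          UniversalFactor.norm_laplaceKernel_le a s
      _ ≤ C * Real.exp (-|s|) * Real.exp (-|s| ^ 3) := hle s
      _ ≤ C * 1 * Real.exp (-|s| ^ 3) :=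
          mul_le_mul_of_nonneg_right (mul_le_mul_of_nonneg_left h1 hC) (Real.exp_pos _).le
      _ = C * Real.exp (-|s| ^ (3 : ℝ)) := by
          rw [mul_one, show (3 : ℝ) = ((3 : ℕ) : ℝ) by norm_num, Real.rpow_natCast]

/-- **`∫_ℝ Φ(|s|)/(1 + s²/a²) e^{izs} ds = 2 F_a(z)`**: the Laplace-smoothed transform as a de Bruijn
trigonometric integral (fold `ℝ` onto `(0, ∞)`, `e^{izs} + e^{−izs} = 2cos(zs)`; cf.
`trigIntegral_deBruijnKernel`). [folklore] -/
theorem UniversalFactor.trigIntegral_laplaceKernel (a : ℝ) (z : ℂ) :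
    trigIntegral (fun s : ℝ ↦ ((Newman.evenPhi s / (1 + s ^ 2 / a ^ 2) : ℝ) : ℂ)) z =
      2 * deBruijnHDiv (fun u : ℝ => 1 + u ^ 2 / a ^ 2) z := by
  have hF := UniversalFactor.isAdmissible_laplaceKernel a
  set k : ℝ → ℂ := fun s ↦ ((Newman.evenPhi s / (1 + s ^ 2 / a ^ 2) : ℝ) : ℂ) *
    Complex.exp (Complex.I * z * s) with hk
  have hki : Integrable k :=
    integrable_mul_cexp_of_exp_moment hF.integrable.aestronglyMeasurable z
      (hF.integrable_norm_mul_exp ‖z‖)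
  have h1 : trigIntegral (fun s : ℝ ↦ ((Newman.evenPhi s / (1 + s ^ 2 / a ^ 2) : ℝ) : ℂ)) z =
      (∫ s in Iic (0 : ℝ), k s) + ∫ s in Ioi (0 : ℝ), k s := by
    rw [trigIntegral, intervalIntegral.integral_Iic_add_Ioi hki.integrableOn hki.integrableOn]
  have h2 : ∫ s in Iic (0 : ℝ), k s = ∫ s in Ioi (0 : ℝ), k (-s) := by
    rw [integral_comp_neg_Ioi, neg_zero]
  have hki' : IntegrableOn (fun s ↦ k (-s)) (Ioi 0) := hki.comp_neg.integrableOn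
  rw [h1, h2, ← integral_add hki' hki.integrableOn, deBruijnHDiv, ← integral_const_mul]
  refine setIntegral_congr_fun measurableSet_Ioi fun s (hs : 0 < s) ↦ ?_
  have hcos : Complex.exp (Complex.I * z * ((-s : ℝ) : ℂ)) + Complex.exp (Complex.I * z * s) =
      2 * Complex.cos (z * s) := by
    rw [Complex.two_cos]
    push_cast
    ring_nf
  simp only [hk]
  rw [Newman.evenPhi_neg, neg_sq, ← mul_add, hcos, Newman.evenPhi_of_nonneg hs.le]
  push_cast
  ring

/-- **`F_a` is a real entire function of order `< 2`** (de Bruijn 1950, Thm. 10, applied to the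
admissible Laplace kernel): `‖F_a(z)‖ ≤ C e^{‖z‖^ρ}` for some `0 ≤ ρ < 2`. [cite: Bruijn1950, Thm. 10] -/
theorem UniversalFactor.exists_growth_deBruijnHDiv_laplace (a : ℝ) :
    ∃ ρ C : ℝ, 0 ≤ ρ ∧ ρ < 2 ∧
      ∀ z, ‖deBruijnHDiv (fun u : ℝ => 1 + u ^ 2 / a ^ 2) z‖ ≤ C * Real.exp (‖z‖ ^ ρ) := by
  obtain ⟨ρ, C₀, hρ0, hρ, h⟩ := (UniversalFactor.isAdmissible_laplaceKernel a).exists_order_bound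
  refine ⟨ρ, C₀ / 2, hρ0, hρ, fun z ↦ ?_⟩
  have h1 := h z
  rw [UniversalFactor.trigIntegral_laplaceKernel, norm_mul, Complex.norm_two] at h1
  linarith

/-! ## The Laguerre lift and the assembly -/

/-- **`LaguerreLift`** (route `UniversalFactor`, item stmt-RiemannHypothesis-2579): for every `a > 0`,
if `F_a` has only real zeros then so has `H_0`. With `F = F_a` (real entire of order `< 2`) put
`G = F' + aF`; then `G' − aG = F'' − a²F = −a² H_0` (`deBruijnHDiv_laplace_sub_deriv_deriv`).
Laguerre's step for `(F, a)` gives `G ≡ 0` or `G` real-rooted, and for `(G, −a)` gives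
`G' − aG ≡ 0` or real-rooted; both degenerate cases would force `H_0 ≡ 0`, contradicting
`exists_deBruijnH_ne_zero`. [folklore] -/
theorem UniversalFactor.laguerreLift : UniversalFactor.LaguerreLift := by
  intro a ha hFa
  set m : ℝ → ℝ := fun u => 1 + u ^ 2 / a ^ 2 with hm
  set F : ℂ → ℂ := deBruijnHDiv m with hFdef
  have hzero : ∀ z, F z = 0 → z.im = 0 := hFa
  have hFd : Differentiable ℂ F := differentiable_deBruijnHDiv_laplace a
  have hFreal : ∀ x : ℝ, (F x).im = 0 := fun x ↦ deBruijnHDiv_ofReal_im m x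
  obtain ⟨ρ, C, hρ0, hρ, hgr⟩ := UniversalFactor.exists_growth_deBruijnHDiv_laplace a
  -- the intermediate function `G = F' + aF`
  set G : ℂ → ℂ := fun z ↦ deriv F z + (a : ℂ) * F z with hGdef
  have hFd' : Differentiable ℂ (deriv F) := hFd.deriv
  have hGd : Differentiable ℂ G := hFd'.add (hFd.const_mul _)
  have hderivG : ∀ z, deriv G z = deriv (deriv F) z + (a : ℂ) * deriv F z := fun z ↦ by
    have h := ((hFd' z).hasDerivAt).add (((hFd z).hasDerivAt).const_mul (a : ℂ))
    exact h.deriv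
  have hODE : ∀ z, F z - deriv (deriv F) z / (a : ℂ) ^ 2 = deBruijnH 0 z := fun z ↦
    deBruijnHDiv_laplace_sub_deriv_deriv a z
  have ha0 : (a : ℂ) ≠ 0 := by exact_mod_cast ha.ne'
  have hH : ∀ z, deBruijnH 0 z = -(deriv G z + (-(a : ℝ) : ℝ) * G z) / (a : ℂ) ^ 2 := by
    intro z
    rw [← hODE z, hderivG]
    simp only [hGdef]
    push_cast
    field_simp
    ring
  obtain ⟨z₁, hz₁⟩ := exists_deBruijnH_ne_zero 0
  have hGreal : ∀ x : ℝ, (G x).im = 0 := fun x ↦ by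
    simp only [hGdef, Complex.add_im, Complex.mul_im, Complex.ofReal_re, Complex.ofReal_im,
      zero_mul, add_zero, im_deriv_ofReal hFd hFreal x, hFreal x, mul_zero]
  rcases UniversalFactor.laguerre_step hFd hρ0 hρ hgr hFreal hzero a with hG0 | hGz
  · -- `G ≡ 0` would give `H_0 ≡ 0`
    exfalso
    apply hz₁
    have hG0' : G = 0 := funext hG0
    rw [hH, hG0']
    simp
  · obtain ⟨ρ', C', hρ'0, hρ', hgr'⟩ :=
      UniversalFactor.exists_growth_deriv_add_mul hFd hρ0 hρ hgr (a : ℂ)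
    rcases UniversalFactor.laguerre_step hGd hρ'0 hρ' hgr' hGreal hGz (-a) with hK0 | hKz
    · exfalso
      apply hz₁
      rw [hH, hK0]
      simp
    · intro z hz
      refine hKz z ?_
      have h := hH z
      rw [hz] at h
      have ha0 : (a : ℂ) ^ 2 ≠ 0 := pow_ne_zero 2 (by exact_mod_cast ha.ne')
      have := (div_eq_zero_iff.1 h.symm).resolve_right ha0
      exact neg_eq_zero.1 this

/-- **`Assembly`** (route `UniversalFactor`, item stmt-RiemannHypothesis-2584): the loophole implies
the Riemann hypothesis — a real-rooted `F_a` lifts through `1 − D²/a²` to a real-rooted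
`H_0 = ξ(1/2 + iz/2)/8` (`laguerreLift`), which is RH
(`riemannHypothesis_iff_hasOnlyRealZeros_deBruijnH_zero_holds`). [folklore] -/
theorem UniversalFactor.assembly : UniversalFactor.Assembly := fun ⟨a, ha, h⟩ ↦
  Summit.RiemannHypothesis_iff.mpr
    (riemannHypothesis_iff_hasOnlyRealZeros_deBruijnH_zero_holds.mpr
      (UniversalFactor.laguerreLift a ha h))

end Summit.RiemannHypothesis.RiemannHypothesis.Theorems
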